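import Summits.QuantumFields.BalabanUV.Beta.BoxPoincare
import Literature.MathematicalPhysics.QuantumFieldTheory.Balaban1983to89.B9Thm37GlueTorusCovLevelsPoinc

/-!
# Beta / CovariantBoxPoincare — THE COVARIANT BLOCK POINCARÉ INEQUALITY IN THE pv21 `covD` CURRENCY: on a block charted by a
# box `(Fin n)^ν`, for ANY bond matrices `Rm` and any orthogonal «tree-gauge» transports `T` whose thin-loop holonomies
# `T(x)·Rm(b)·T(y)ᵀ` are `h`-close to `1` on the in-block bonds, the block mass of a field is paid by its in-block covariant
# energy and its covariant block sum — `(1 − 4P·ν·h²)·Σ_{x∈β}|f(x)|² ≤ (4P/c²)·Σ_{b⊂β}|(∇_U f)(b)|² + (2/n^ν)·|Σ_{x∈β} T(x)f(x)|²`,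
# `P = ν·n(n−1)` — with NO hypothesis on `Rm` and constants of order (block side)²
# (unit `b2b-balaban-beta-d4-p2`, GEN 7, MODEL crew; claim «MULTISCALE-POINCARE-MODEL» journal l.16779; part (B) of three)

HONEST FRAMING: discharging `BetaPertH` makes Bałaban's UV stability UNCONDITIONAL — NOT the continuum limit, NOT the
Clay problem.  HONEST DEPENDENCY (verbatim): «continuum YM on T⁴ ⇐ BetaPertH ∧ nine spine estimates (0/9 proved);
BetaPertH ⇐ (D1) ∧ (D4) ∧ CAP+tail; G-an2-4 gates asym, D1 and NE2/3/4.»  THIS MODULE DISCHARGES NOTHING of `BetaPertH`,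
asserts NOTHING printed and cites nothing as a fact (ABSOLUTE RULE): [folklore] lattice calculus about the pv21 component MODEL
(`B9Thm37Glue.covD`: sites `St`, bonds `Bd`, bond weights `c`, bond matrices `Rm(b)` as DATA) — the box chart `φ`, the in-box
bonds `e`, the transports `T` and the defect `h` are DATA; which `T` (the B5 (1.7) tree transports), which `h` (gen-6 (P):
`h ≤ ν(n−1)·α` from the in-block plaquettes, `CovariantPlateauBlocks.hdef_le_of_plaqW`; or `(2ν(n−1)+1)·ε` from a (3.35)-shape
gauge) and which blocks (the cells of [B9] (3.24)'s regions `Λ_j`) is the business of part (C) and of NODE O.2.  SHAPES located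
at [B9] = `Balaban1985BackgroundPropagators` (3.24) p. 394, (3.35) p. 396, Thm 3.1 p. 397 (the local prefactor `(L^jη)²`).  No
class change on row D4 (critical-path width 0; D4 DISCHARGE NO DATE); NOT BetaPertH, NOT continuum, NOT Clay, NOT summit progress.

THE MECHANISM (tree gauge, one line).  With `g(v) := T(φ v)·f(φ v)` and an in-block bond `b` from `x = φ v` to `y = φ v⁺`:
`g(v⁺) − g(v) = T(x)·(∇_U f)(b)/c(b) − (Hol(b) − 1)·g(v⁺)`, `Hol(b) = T(x)·Rm(b)·T(y)ᵀ` (`tf_succ_sub_tf`); so the FLAT box energy of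
`g` is `≤ 2·(covariant energy)/c² + 2h²·ν·(mass)` and part (A)'s two-term box Poincaré inequality for the components of `g` gives
the END.  j-UNIFORMITY: with `h ≍ ν·n·α` (thin loops) the loss `4Pνh² ≍ 4ν⁴(n²α)²` is n-uniform exactly in print's regime
`n²α = O(Mα₀)` small — the k-uniform replacement of pv21's `2^j`-recursive `towerP`.

CONTENT (kernel, 0 sorry).  §1 component tools (`orth_cancel`, the transported field `tf`, the holonomy `hol`).  §2 the
one-bond identity `tf_succ_sub_tf` and inequality `sum_sq_tf_succ_sub_le`.  §3 box bookkeeping (`sum_dite_succ_le`: each site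
is the head of ≤ ν in-box bonds).  §4 END **`covariant_box_poincare`** and the flat corollary **`flat_box_poincare`**
(`T = 1`, `Rm = 1` on the in-block bonds, `h = 0`).
-/

namespace Summit.QuantumFields.BalabanUV.Beta.CovariantBoxPoincare

open Finset Function
open Summit.QuantumFields.BalabanUV.Beta.BoxPoincare
open Literature.MathematicalPhysics.QuantumFieldTheory.Balaban1983to89.B9Thm37Glue (covD covD_apply)
open Literature.MathematicalPhysics.QuantumFieldTheory.Balaban1983to89.B9Thm37GlueTorusCovLevelsPoinc (sum_sq_orth_apply)

noncomputable section

variable {St Bd Cp : Type} [Fintype Cp] [DecidableEq Cp] {ν n : ℕ}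

/-! ## §1 Component tools -/

/-- Orthonormal columns cancel: `Σ_j P_{jl}·(Σ_m P_{jm} w_m) = w_l`. [folklore] -/
theorem orth_cancel {P : Cp → Cp → ℝ} (hP : ∀ i i', ∑ k, P k i * P k i' = if i = i' then (1 : ℝ) else 0)
    (w : Cp → ℝ) (l : Cp) : ∑ j, P j l * ∑ m, P j m * w m = w l := by
  calc ∑ j, P j l * ∑ m, P j m * w m = ∑ m, (∑ j, P j l * P j m) * w m := by
        simp_rw [Finset.mul_sum]
        rw [Finset.sum_comm]
        refine Finset.sum_congr rfl fun m _ => ?_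
        rw [Finset.sum_mul]
        exact Finset.sum_congr rfl fun j _ => by ring
    _ = w l := by
        simp_rw [hP l]
        simp

/-- The transported («tree-gauged») field on the box: `g(v)_a = Σ_k T(v)_{ak} f(φ v, k)`. [folklore] -/
def tf (T : Box ν n → Cp → Cp → ℝ) (φ : Box ν n → St) (f : St × Cp → ℝ) (v : Box ν n) (a : Cp) : ℝ :=
  ∑ k, T v a k * f (φ v, k)

/-- The in-box successor `v + e_i`. [folklore] -/
def succ (v : Box ν n) (i : Fin ν) (hv : (v i : ℕ) + 1 < n) : Box ν n := update v i ⟨(v i : ℕ) + 1, hv⟩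

/-- The thin-loop holonomy of the in-box bond `(v, i)` in the tree gauge: `Hol = T(v)·Rm(e)·T(v⁺)ᵀ`, in components
`Hol_{aj} = Σ_k Σ_l T(v)_{ak} Rm(e)_{kl} T(v⁺)_{jl}`. [cite: Balaban1985BackgroundPropagators, (3.19) p.393 + (3.35) p.396] -/
def hol (Rm : Bd → Cp → Cp → ℝ) (T : Box ν n → Cp → Cp → ℝ)
    (e : (v : Box ν n) → (i : Fin ν) → ((v i : ℕ) + 1 < n) → Bd) (v : Box ν n) (i : Fin ν) (hv : (v i : ℕ) + 1 < n)
    (a j : Cp) : ℝ :=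
  ∑ k, ∑ l, T v a k * Rm (e v i hv) k l * T (succ v i hv) j l

/-! ## §2 One bond: the tree-gauge identity and inequality -/

section OneBond

variable {src tgt : Bd → St} (φ : Box ν n → St) (e : (v : Box ν n) → (i : Fin ν) → ((v i : ℕ) + 1 < n) → Bd)
  (c : Bd → ℝ) (Rm : Bd → Cp → Cp → ℝ) (T : Box ν n → Cp → Cp → ℝ)

/-- The holonomy acting on the gauged field at the head reproduces the transported raw field:
`Σ_j Hol_{aj} g(v⁺)_j = Σ_k T(v)_{ak} (Rm(e) f(φ v⁺))_k` (orthonormality of `T(v⁺)`). [folklore] -/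
theorem hol_apply_tf (hT : ∀ v i i', ∑ k, T v k i * T v k i' = if i = i' then (1 : ℝ) else 0) (f : St × Cp → ℝ)
    (v : Box ν n) (i : Fin ν) (hv : (v i : ℕ) + 1 < n) (a : Cp) :
    ∑ j, hol Rm T e v i hv a j * tf T φ f (succ v i hv) j =
      ∑ k, T v a k * ∑ l, Rm (e v i hv) k l * f (φ (succ v i hv), l) := by
  unfold hol tf
  calc ∑ j, (∑ k, ∑ l, T v a k * Rm (e v i hv) k l * T (succ v i hv) j l) *
          ∑ m, T (succ v i hv) j m * f (φ (succ v i hv), m)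
      = ∑ k, ∑ l, T v a k * Rm (e v i hv) k l *
          ∑ j, T (succ v i hv) j l * ∑ m, T (succ v i hv) j m * f (φ (succ v i hv), m) := by
        simp_rw [Finset.sum_mul, Finset.mul_sum]
        rw [Finset.sum_comm]
        refine Finset.sum_congr rfl fun k _ => ?_
        rw [Finset.sum_comm]
        refine Finset.sum_congr rfl fun l _ => Finset.sum_congr rfl fun j _ => ?_
        exact Finset.sum_congr rfl fun m _ => by ring
    _ = ∑ k, T v a k * ∑ l, Rm (e v i hv) k l * f (φ (succ v i hv), l) := by
        refine Finset.sum_congr rfl fun k _ => ?_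
        rw [Finset.mul_sum]
        refine Finset.sum_congr rfl fun l _ => ?_
        rw [orth_cancel (hT (succ v i hv)) (fun m => f (φ (succ v i hv), m)) l]
        ring

/-- **The tree-gauge identity.** For an in-box bond from `φ v` to `φ v⁺` with weight `c ≠ 0`:
`g(v⁺)_a − g(v)_a = Σ_k T(v)_{ak}·(∇_U f)(e)_k/c(e) − Σ_j (Hol_{aj} − δ_{aj})·g(v⁺)_j`. [folklore] -/
theorem tf_succ_sub_tf (hsrc : ∀ v i hv, src (e v i hv) = φ v) (htgt : ∀ v i hv, tgt (e v i hv) = φ (succ v i hv))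
    (hT : ∀ v i i', ∑ k, T v k i * T v k i' = if i = i' then (1 : ℝ) else 0) (f : St × Cp → ℝ)
    (v : Box ν n) (i : Fin ν) (hv : (v i : ℕ) + 1 < n) (hc : c (e v i hv) ≠ 0) (a : Cp) :
    tf T φ f (succ v i hv) a - tf T φ f v a =
      ∑ k, T v a k * (covD src tgt c Rm f (e v i hv, k) / c (e v i hv)) -
        ∑ j, (hol Rm T e v i hv a j - if a = j then 1 else 0) * tf T φ f (succ v i hv) j := by
  have h1 : ∑ j, (hol Rm T e v i hv a j - if a = j then 1 else 0) * tf T φ f (succ v i hv) j =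
      (∑ k, T v a k * ∑ l, Rm (e v i hv) k l * f (φ (succ v i hv), l)) - tf T φ f (succ v i hv) a := by
    simp_rw [sub_mul]
    rw [Finset.sum_sub_distrib, hol_apply_tf φ e Rm T hT f v i hv a]
    congr 1
    simp
  have h2 : ∑ k, T v a k * (covD src tgt c Rm f (e v i hv, k) / c (e v i hv)) =
      (∑ k, T v a k * ∑ l, Rm (e v i hv) k l * f (φ (succ v i hv), l)) - tf T φ f v a := by
    unfold tf
    rw [← Finset.sum_sub_distrib]
    refine Finset.sum_congr rfl fun k _ => ?_
    rw [covD_apply, hsrc, htgt]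
    field_simp
  rw [h1, h2]
  ring

/-- **The one-bond inequality.** `Σ_a (g(v⁺)_a − g(v)_a)² ≤ 2·Σ_k (∇_U f)(e)_k²/c_min² + 2h²·Σ_k f(φ v⁺, k)²` whenever
`c_min ≤ |c(e)|` and the holonomy defect is `≤ h` in operator form. [folklore] -/
theorem sum_sq_tf_succ_sub_le (hsrc : ∀ v i hv, src (e v i hv) = φ v)
    (htgt : ∀ v i hv, tgt (e v i hv) = φ (succ v i hv))
    (hT : ∀ v i i', ∑ k, T v k i * T v k i' = if i = i' then (1 : ℝ) else 0) {cmin : ℝ} (hcmin : 0 < cmin)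
    (hcb : ∀ v i hv, cmin ≤ |c (e v i hv)|) {h : ℝ}
    (hHol : ∀ v i hv (u : Cp → ℝ),
      ∑ a, (∑ j, (hol Rm T e v i hv a j - if a = j then 1 else 0) * u j) ^ 2 ≤ h ^ 2 * ∑ j, u j ^ 2)
    (f : St × Cp → ℝ) (v : Box ν n) (i : Fin ν) (hv : (v i : ℕ) + 1 < n) :
    ∑ a, (tf T φ f (succ v i hv) a - tf T φ f v a) ^ 2 ≤
      2 / cmin ^ 2 * ∑ k, covD src tgt c Rm f (e v i hv, k) ^ 2 + 2 * h ^ 2 * ∑ k, f (φ (succ v i hv), k) ^ 2 := by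
  have hc0 : c (e v i hv) ≠ 0 := fun h0 => by
    have := hcb v i hv; rw [h0, abs_zero] at this; linarith
  -- the two pieces of the identity
  set A : Cp → ℝ := fun a => ∑ k, T v a k * (covD src tgt c Rm f (e v i hv, k) / c (e v i hv)) with hA
  set B : Cp → ℝ := fun a => ∑ j, (hol Rm T e v i hv a j - if a = j then 1 else 0) * tf T φ f (succ v i hv) j
    with hB
  have hid : ∀ a, tf T φ f (succ v i hv) a - tf T φ f v a = A a - B a := fun a =>
    tf_succ_sub_tf φ e c Rm T hsrc htgt hT f v i hv hc0 a
  -- piece A: isometry of T(v), then 1/c² ≤ 1/c_min²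
  have hAsq : ∑ a, A a ^ 2 ≤ 1 / cmin ^ 2 * ∑ k, covD src tgt c Rm f (e v i hv, k) ^ 2 := by
    rw [hA, sum_sq_orth_apply (hT v)]
    rw [Finset.mul_sum]
    refine Finset.sum_le_sum fun k _ => ?_
    rw [div_pow, div_eq_mul_inv, mul_comm, one_div]
    refine mul_le_mul_of_nonneg_right ?_ (sq_nonneg _)
    have hcb' := hcb v i hv
    rw [← sq_abs (c _)]
    exact inv_anti₀ (by positivity) (pow_le_pow_left₀ hcmin.le hcb' 2)
  -- piece B: the defect bound, then isometry of T(v⁺)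
  have hBsq : ∑ a, B a ^ 2 ≤ h ^ 2 * ∑ k, f (φ (succ v i hv), k) ^ 2 := by
    rw [hB]
    refine (hHol v i hv (tf T φ f (succ v i hv))).trans (le_of_eq ?_)
    congr 1
    exact sum_sq_orth_apply (hT (succ v i hv)) (fun k => f (φ (succ v i hv), k))
  calc ∑ a, (tf T φ f (succ v i hv) a - tf T φ f v a) ^ 2 = ∑ a, (A a - B a) ^ 2 :=
        Finset.sum_congr rfl fun a _ => by rw [hid a]
    _ ≤ ∑ a, (2 * A a ^ 2 + 2 * B a ^ 2) :=
        Finset.sum_le_sum fun a _ => by nlinarith [sq_nonneg (A a + B a)]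
    _ = 2 * ∑ a, A a ^ 2 + 2 * ∑ a, B a ^ 2 := by rw [Finset.sum_add_distrib, Finset.mul_sum, Finset.mul_sum]
    _ ≤ 2 * (1 / cmin ^ 2 * ∑ k, covD src tgt c Rm f (e v i hv, k) ^ 2) +
          2 * (h ^ 2 * ∑ k, f (φ (succ v i hv), k) ^ 2) := by linarith
    _ = 2 / cmin ^ 2 * ∑ k, covD src tgt c Rm f (e v i hv, k) ^ 2 + 2 * h ^ 2 * ∑ k, f (φ (succ v i hv), k) ^ 2 := by
        ring

end OneBond

/-! ## §3 Box bookkeeping -/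

/-- Each site is the head of at most one in-box bond per direction: for `F ≥ 0`,
`Σ_v [v + e_i in the box]·F(v + e_i) ≤ Σ_w F(w)`. [folklore] -/
theorem sum_dite_succ_le (i : Fin ν) (F : Box ν n → ℝ) (hF : ∀ w, 0 ≤ F w) :
    ∑ v : Box ν n, (if hv : (v i : ℕ) + 1 < n then F (succ v i hv) else 0) ≤ ∑ w, F w := by
  classical
  -- total successor map (junk value `v` off the box face) and its injectivity on the good set
  let sT : Box ν n → Box ν n := fun v => if hv : (v i : ℕ) + 1 < n then succ v i hv else v
  let good : Finset (Box ν n) := Finset.univ.filter fun v => (v i : ℕ) + 1 < n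
  have hinj : Set.InjOn sT good := by
    intro v hv v' hv' hEq
    have hv1 : (v i : ℕ) + 1 < n := (Finset.mem_filter.mp hv).2
    have hv1' : (v' i : ℕ) + 1 < n := (Finset.mem_filter.mp hv').2
    simp only [sT, dif_pos hv1, dif_pos hv1', succ] at hEq
    funext j
    by_cases hji : j = i
    · subst hji
      have := congrFun hEq j
      simp only [update_self, Fin.mk.injEq] at this
      exact Fin.ext (by omega)
    · have := congrFun hEq j
      rwa [update_of_ne hji, update_of_ne hji] at this
  calc ∑ v : Box ν n, (if hv : (v i : ℕ) + 1 < n then F (succ v i hv) else 0)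
      = ∑ v ∈ good, F (sT v) := by
        rw [Finset.sum_filter]
        refine Finset.sum_congr rfl fun v _ => ?_
        by_cases hv : (v i : ℕ) + 1 < n
        · simp [sT, hv]
        · simp [hv]
    _ = ∑ w ∈ good.image sT, F w := (Finset.sum_image hinj).symm
    _ ≤ ∑ w, F w := Finset.sum_le_univ_sum_of_nonneg hF

/-! ## §4 The covariant block Poincaré inequality -/

section Main

variable {src tgt : Bd → St}

/-- **THE COVARIANT BLOCK POINCARÉ INEQUALITY (pv21 `covD` currency, MODEL).**  Data: a box chart `φ : (Fin n)^ν → St`, the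
in-box bonds `e v i` from `φ v` to `φ(v + e_i)` with weights `|c| ≥ c_min > 0`, ANY bond matrices `Rm`, orthogonal transports
`T(v)` with thin-loop defect `‖T(v)Rm(e)T(v⁺)ᵀ − 1‖ ≤ h` (operator form).  Then, with `P = ν·n·(n−1)`:
`(1 − 4P·ν·h²)·Σ_v |f(φ v)|² ≤ (4P/c_min²)·Σ_{in-box bonds} |(∇_U f)(e)|² + (2/n^ν)·Σ_a (Σ_v (T(v)f(φ v))_a)²` — mass paid by
in-block covariant energy and the covariant block sum, constant of order (side)², no hypothesis on `Rm`.
[cite: Balaban1985BackgroundPropagators, (3.24) p.394 + (3.35) p.396] -/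
theorem covariant_box_poincare (φ : Box ν n → St) (e : (v : Box ν n) → (i : Fin ν) → ((v i : ℕ) + 1 < n) → Bd)
    (hsrc : ∀ v i hv, src (e v i hv) = φ v) (htgt : ∀ v i hv, tgt (e v i hv) = φ (succ v i hv))
    (c : Bd → ℝ) {cmin : ℝ} (hcmin : 0 < cmin) (hcb : ∀ v i hv, cmin ≤ |c (e v i hv)|)
    (Rm : Bd → Cp → Cp → ℝ) (T : Box ν n → Cp → Cp → ℝ)
    (hT : ∀ v i i', ∑ k, T v k i * T v k i' = if i = i' then (1 : ℝ) else 0) {h : ℝ}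
    (hHol : ∀ v i hv (u : Cp → ℝ),
      ∑ a, (∑ j, (hol Rm T e v i hv a j - if a = j then 1 else 0) * u j) ^ 2 ≤ h ^ 2 * ∑ j, u j ^ 2)
    (f : St × Cp → ℝ) :
    (1 - 4 * ((ν : ℝ) * n * ((n : ℝ) - 1)) * ν * h ^ 2) * ∑ v : Box ν n, ∑ k, f (φ v, k) ^ 2 ≤
      4 * ((ν : ℝ) * n * ((n : ℝ) - 1)) / cmin ^ 2 *
          ∑ v : Box ν n, ∑ i : Fin ν,
            (if hv : (v i : ℕ) + 1 < n then ∑ k, covD src tgt c Rm f (e v i hv, k) ^ 2 else 0) +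
        2 / (n : ℝ) ^ ν * ∑ a, (∑ v : Box ν n, tf T φ f v a) ^ 2 := by
  set P : ℝ := (ν : ℝ) * n * ((n : ℝ) - 1) with hP
  set Sf : ℝ := ∑ v : Box ν n, ∑ k, f (φ v, k) ^ 2 with hSf
  set E : ℝ := ∑ v : Box ν n, ∑ i : Fin ν,
    (if hv : (v i : ℕ) + 1 < n then ∑ k, covD src tgt c Rm f (e v i hv, k) ^ 2 else 0) with hE
  have hPnn : 0 ≤ P := by
    rw [hP]
    rcases Nat.eq_zero_or_pos n with hn | hn
    · subst hn; simp
    · have : (1 : ℝ) ≤ n := by exact_mod_cast hn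
      have : (0 : ℝ) ≤ (n : ℝ) - 1 := by linarith
      positivity
  -- part (A) for the components of the gauged field
  have hA := sum_sq_le_energy_add_mean_comp (fun v a => tf T φ f v a)
  -- the gauged field has the same block mass (isometry)
  have hmass : ∑ v : Box ν n, ∑ a, tf T φ f v a ^ 2 = Sf := by
    rw [hSf]
    exact Finset.sum_congr rfl fun v _ => sum_sq_orth_apply (hT v) (fun k => f (φ v, k))
  -- the flat energy of the gauged field ≤ 2E/c² + 2h²·ν·Sf
  have henergy : ∑ a, energy (fun v => tf T φ f v a) ≤ 2 / cmin ^ 2 * E + 2 * h ^ 2 * (ν * Sf) := by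
    have hswap : ∑ a, energy (fun v => tf T φ f v a) =
        ∑ v : Box ν n, ∑ i : Fin ν, ∑ a, bd (fun v => tf T φ f v a) v i ^ 2 := by
      unfold energy
      rw [Finset.sum_comm]
      exact Finset.sum_congr rfl fun v _ => Finset.sum_comm
    have hbond : ∀ (v : Box ν n) (i : Fin ν), ∑ a, bd (fun v => tf T φ f v a) v i ^ 2 ≤
        (if hv : (v i : ℕ) + 1 < n then
          2 / cmin ^ 2 * ∑ k, covD src tgt c Rm f (e v i hv, k) ^ 2 +
            2 * h ^ 2 * ∑ k, f (φ (succ v i hv), k) ^ 2 else 0) := by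
      intro v i
      by_cases hv : (v i : ℕ) + 1 < n
      · rw [dif_pos hv]
        have := sum_sq_tf_succ_sub_le φ e c Rm T hsrc htgt hT hcmin hcb hHol f v i hv
        refine le_trans (le_of_eq ?_) this
        refine Finset.sum_congr rfl fun a _ => ?_
        simp only [bd, dif_pos hv, succ]
      · rw [dif_neg hv]
        refine le_of_eq (Finset.sum_eq_zero fun a _ => ?_)
        simp [bd, dif_neg hv]
    have hheads : ∀ i : Fin ν, ∑ v : Box ν n,
        (if hv : (v i : ℕ) + 1 < n then ∑ k, f (φ (succ v i hv), k) ^ 2 else 0) ≤ Sf :=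
      fun i => sum_dite_succ_le i (fun w => ∑ k, f (φ w, k) ^ 2) fun w => sum_nonneg fun _ _ => sq_nonneg _
    calc ∑ a, energy (fun v => tf T φ f v a)
        = ∑ v : Box ν n, ∑ i : Fin ν, ∑ a, bd (fun v => tf T φ f v a) v i ^ 2 := hswap
      _ ≤ ∑ v : Box ν n, ∑ i : Fin ν, (if hv : (v i : ℕ) + 1 < n then
            2 / cmin ^ 2 * ∑ k, covD src tgt c Rm f (e v i hv, k) ^ 2 +
              2 * h ^ 2 * ∑ k, f (φ (succ v i hv), k) ^ 2 else 0) :=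
          Finset.sum_le_sum fun v _ => Finset.sum_le_sum fun i _ => hbond v i
      _ = 2 / cmin ^ 2 * E + 2 * h ^ 2 * ∑ v : Box ν n, ∑ i : Fin ν,
            (if hv : (v i : ℕ) + 1 < n then ∑ k, f (φ (succ v i hv), k) ^ 2 else 0) := by
          rw [hE, Finset.mul_sum, Finset.mul_sum, ← Finset.sum_add_distrib]
          refine Finset.sum_congr rfl fun v _ => ?_
          rw [Finset.mul_sum, Finset.mul_sum, ← Finset.sum_add_distrib]
          refine Finset.sum_congr rfl fun i _ => ?_
          by_cases hv : (v i : ℕ) + 1 < n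
          · simp only [dif_pos hv]
          · simp only [dif_neg hv, mul_zero, add_zero]
      _ ≤ 2 / cmin ^ 2 * E + 2 * h ^ 2 * (ν * Sf) := by
          have hsum : ∑ v : Box ν n, ∑ i : Fin ν,
              (if hv : (v i : ℕ) + 1 < n then ∑ k, f (φ (succ v i hv), k) ^ 2 else 0) ≤ ν * Sf := by
            rw [Finset.sum_comm]
            calc _ ≤ ∑ _i : Fin ν, Sf := Finset.sum_le_sum fun i _ => hheads i
              _ = ν * Sf := by rw [Finset.sum_const, Finset.card_univ, Fintype.card_fin, nsmul_eq_mul]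
          have : 0 ≤ 2 * h ^ 2 := by positivity
          nlinarith
  -- assemble
  rw [hmass] at hA
  have h2P : 0 ≤ 2 * P := by positivity
  have hchain : Sf ≤ 2 * P * (2 / cmin ^ 2 * E + 2 * h ^ 2 * (ν * Sf)) +
      2 / (n : ℝ) ^ ν * ∑ a, (∑ v : Box ν n, tf T φ f v a) ^ 2 :=
    hA.trans (by nlinarith [mul_le_mul_of_nonneg_left henergy h2P])
  have hrew : (1 - 4 * P * ν * h ^ 2) * Sf =
      Sf - 2 * P * (2 * h ^ 2 * (ν * Sf)) := by ring
  rw [hrew]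
  have : 2 * P * (2 / cmin ^ 2 * E) = 4 * P / cmin ^ 2 * E := by ring
  linarith

/-- **The flat corollary (`U = 1` on the block).**  Transports `T = 1` and bond matrices `Rm(e) = 1` on the in-box bonds:
`Σ_v |f(φ v)|² ≤ (4P/c_min²)·Σ_{in-box bonds}|(∇f)(e)|² + (2/n^ν)·Σ_a (Σ_v f(φ v, a))²`, `P = ν·n·(n−1)`. [folklore] -/
theorem flat_box_poincare (φ : Box ν n → St) (e : (v : Box ν n) → (i : Fin ν) → ((v i : ℕ) + 1 < n) → Bd)
    (hsrc : ∀ v i hv, src (e v i hv) = φ v) (htgt : ∀ v i hv, tgt (e v i hv) = φ (succ v i hv))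
    (c : Bd → ℝ) {cmin : ℝ} (hcmin : 0 < cmin) (hcb : ∀ v i hv, cmin ≤ |c (e v i hv)|)
    (Rm : Bd → Cp → Cp → ℝ) (hRm : ∀ v i hv k l, Rm (e v i hv) k l = if k = l then 1 else 0)
    (f : St × Cp → ℝ) :
    ∑ v : Box ν n, ∑ k, f (φ v, k) ^ 2 ≤
      4 * ((ν : ℝ) * n * ((n : ℝ) - 1)) / cmin ^ 2 *
          ∑ v : Box ν n, ∑ i : Fin ν,
            (if hv : (v i : ℕ) + 1 < n then ∑ k, covD src tgt c Rm f (e v i hv, k) ^ 2 else 0) +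
        2 / (n : ℝ) ^ ν * ∑ a, (∑ v : Box ν n, f (φ v, a)) ^ 2 := by
  -- identity transports
  let T : Box ν n → Cp → Cp → ℝ := fun _ k l => if k = l then 1 else 0
  have hT : ∀ v i i', ∑ k, T v k i * T v k i' = if i = i' then (1 : ℝ) else 0 := by
    intro v i i'
    simp only [T]
    rw [Finset.sum_eq_single i (fun k _ hk => by rw [if_neg hk, zero_mul]) (fun h => absurd (mem_univ i) h)]
    by_cases h : i = i' <;> simp [h]
  have htf : ∀ v a, tf T φ f v a = f (φ v, a) := by
    intro v a
    simp only [tf, T]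
    rw [Finset.sum_eq_single a (fun k _ hk => by rw [if_neg (Ne.symm hk), zero_mul]) (fun h => absurd (mem_univ a) h)]
    simp
  have hhol : ∀ v i hv a j, hol Rm T e v i hv a j = if a = j then 1 else 0 := by
    intro v i hv a j
    simp only [hol, T, hRm v i hv]
    rw [Finset.sum_eq_single a (fun k _ hk => Finset.sum_eq_zero fun l _ => by rw [if_neg (Ne.symm hk)]; ring)
      (fun h => absurd (mem_univ a) h)]
    rw [Finset.sum_eq_single j (fun l _ hl => by rw [if_neg (Ne.symm hl)]; ring) (fun h => absurd (mem_univ j) h)]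
    by_cases h : a = j <;> simp [h]
  have hHol : ∀ v i hv (u : Cp → ℝ),
      ∑ a, (∑ j, (hol Rm T e v i hv a j - if a = j then 1 else 0) * u j) ^ 2 ≤ (0 : ℝ) ^ 2 * ∑ j, u j ^ 2 := by
    intro v i hv u
    have : ∀ a, ∑ j, (hol Rm T e v i hv a j - if a = j then 1 else 0) * u j = 0 := fun a =>
      Finset.sum_eq_zero fun j _ => by rw [hhol, sub_self, zero_mul]
    simp [this]
  have hmain := covariant_box_poincare φ e hsrc htgt c hcmin hcb Rm T hT hHol f
  simp only [htf] at hmain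
  have h0 : (1 - 4 * ((ν : ℝ) * n * ((n : ℝ) - 1)) * ν * (0 : ℝ) ^ 2) = 1 := by ring
  rw [h0, one_mul] at hmain
  exact hmain

end Main

end

end Summit.QuantumFields.BalabanUV.Beta.CovariantBoxPoincare
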